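import Summits.ABC.StewartYu.ArchG3RecSched
import Summits.ABC.StewartYu.ArchG3PackClosed
import HarnessLib

/-!
# Cell abc-stewartyu, rung A1.L (crux r2 `ArchCoreRat`, stmt-ABC-20502), WP-L.A: the letter lines in CLOSED FORM on the record of reference —
# `ArchG3Rec.LinesClosed` (the record-side half (B) of `stub_recLinesArch`, plan R47; owner of its proof: seat p1)

`Summits/ABC/StewartYu/ArchG3RecLinesClosed.lean` — cell `abc-stewartyu` (HOME `run/shared/lean/pub/abc-stewartyu/`; seat p5 g9 writes the
TEXT, seat p1 proves `linesClosed_holds`).  Plain definitions on `ArchG3Rec n` only (no `ArchG3Setup`, no `SatData`): every θ-charged atom of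
the START-level letter lines `ArchG3Setup.ArchLinesHoldV` (✓ `ArchG3LinesV`) is replaced by its CLOSED-FORM MAJORANT in the record letters,
valid on a weight-sorted lower-triangular saturated basis with the pivot at the last (= heaviest) index (the four shape letters of
`ArchG3Line.LinesSupplyS`; STATUS 2026-08-27 20:58Z finding, R47):

* boxes: `LνRR lev j = (2·Bv j + 1)/2^lev` (= `S.LνR P lev j`), θ-radius majorant `sRR k = (n−1)!·Σ_{j>k}(2Bv j+1) + (2Bv k+1) + 2 ≥ sθR k`,
  θ-box `LbR lev k = (2·sRR k)/2^lev ≥ Lb (sθR) lev k`;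
* sizes: `AθR k = Σ_{j≤k} A j ≥ |log θₖ|`, `Bexp = e^{W−1}` (= B when `W = log(eB)`), `Alast = A ⟨n−1⟩` (= A k₀),
  `btR k = (n−1)!·N·Bexp·Alast·Σ_{j>k} 1/A j + N·Bexp·Alast/A k ≥ |b̃ₖ|`;
* the two directional atoms: jets scalar `ΓR lev k = LbR lev k + 2·btR k·((2Bv last+1)/N + 2)`, `yR lev = Σₖ AθR k·ΓR lev k ≥ Σₖ Aₖ·GammaC k`,
  Cauchy radius `CR lev = max 1 (yR lev / T lev)`; Δ-ceiling `YR lev = Σₖ (Bexp·N·LbR lev k + 2·btR k·(2Bv last+3)) ≥ YC 1 0 (Lb lev)`;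
* globals: `cUR = log(L₀+1) + Σ log(2Bv j+2) ≥ log #unkA`, `logAmaxRR` (lp-1's `log_AmaxR_le` right-hand side at `(c,e) = (1,0)`, `V = A`,
  `YC ≤ YR 0`), `cPR = log 2 + cUR + logAmaxRR ≥ log ⌈#unkA·AmaxR⌉`, `SAR = Σ A j`, `cHR = n·SAR ≥ log ∏H(θⱼ)`, `AθsumR = Σₖ AθR k`;
* ceilings: `U0 c = cⁿ·Ω·W` (−log δ₀), `cbR c lev m = log 2 + log(LbR lev last+1) + log(m+1) − U0 c`, `cDR lev a x` (virtual denominator);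
* **`KStepLinesR c lev ν`, `OddStepLinesR c lev`, `HalfStepLinesR c lev`** — the texts of ✓ `KStepLinesV`/`OddStepLinesV`/`HalfStepLinesV` at
  the record's schedule (`ex := Ŝ − lev`, `t := T lev`, `E := e^G`, `C := CR lev`, `(cl, el) := (1, 0)`, `y/C ↦ t`) with the closed atoms;
  the two box-ceiling conjuncts are dropped (automatic for `cbR`);
* **`LinesClosed c`** — the four families level-wise exactly as in `ArchLinesHoldV`.
`ArchG3LinesAssembly` (p5) proves `LinesClosed c ∧ (θ-side atom bounds) ⇒ ArchLinesHoldV …` at the START's letters; p1 proves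
`linesClosed_holds : 2 ≤ n → c₀ ≤ c → P.LinesClosed c` (pure record arithmetic).

WHAT THIS IS NOT: no inequality is proved here; no START; no crux moves.

## References
* Yu. V. Nesterenko, LNM 1819 (2003) — §4.2 (4.24)–(4.35), §4.3 (4.36)–(4.51), p. 87–95 (the k-step and half-step budgets). [Nesterenko2003]
-/

noncomputable section

open Finset
open scoped Nat
open Summit.ABC.StewartYu.ArchSupply (WC)
open Summit.ABC.StewartYu.ArchG3Setup (DΔC)

namespace Summit.ABC.StewartYu

namespace ArchG3Rec

open ArchG3Par (G)

variable {n : ℕ} (P : ArchG3Rec n)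

/-! ### Indices and datum letters -/

/-- the last index `⟨n−1⟩` (the pivot `j̃₀` of the frame; heaviest weight). [folklore] -/
def jl : Fin n := ⟨n - 1, by have := P.hn; omega⟩

/-- `B` recovered from `W = log(e·B)`: `Bexp = e^{W−1}`. [folklore] -/
def Bexp : ℝ := Real.exp (P.W - 1)

/-- the heaviest weight `A ⟨n−1⟩` (= `A k₀` for a sorted datum). [folklore] -/
def Alast : ℝ := P.A P.jl

/-- `Σⱼ Aⱼ`. [folklore] -/
def SAR : ℝ := ∑ j, P.A j

/-- `AθR k = Σ_{j ≤ k} Aⱼ` — majorant of `|log θₖ|` on a lower-triangular saturated basis. [cite: Nesterenko2003, §3.4 (the basis of 𝔑); shape only] -/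
def AθR (k : Fin n) : ℝ := ∑ j ∈ Iic k, P.A j

/-- `Σₖ AθR k`. [folklore] -/
def AθsumR : ℝ := ∑ k, P.AθR k

/-! ### Boxes -/

/-- the virtual box schedule `LνRR lev j = (2·Bv j + 1)/2^lev` (= `S.LνR P lev j`). [cite: Nesterenko2003, §4.3 (4.48); shape only] -/
def LνRR (lev : ℕ) (j : Fin n) : ℕ := (2 * P.Bv j + 1) / 2 ^ lev

/-- θ-radius majorant `sRR k = (n−1)!·Σ_{j>k}(2Bv j+1) + (2Bv k+1) + 2 ≥ sθR F P k`. [cite: Nesterenko2003, §3.5 (3.25); shape only] -/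
def sRR (k : Fin n) : ℕ := (n - 1)! * ∑ j ∈ Ioi k, (2 * P.Bv j + 1) + (2 * P.Bv k + 1) + 2

/-- θ-box majorant `LbR lev k = (2·sRR k)/2^lev ≥ Lb (sθR F P) lev k`. [cite: Nesterenko2003, §4 (4.1), §4.3 (4.48); shape only] -/
def LbR (lev : ℕ) (k : Fin n) : ℕ := (2 * P.sRR k) / 2 ^ lev

/-- `btR k = (n−1)!·N·B·Alast·Σ_{j>k} 1/Aⱼ + N·B·Alast/Aₖ ≥ |b̃ₖ| = |Σ_{j≥k} bⱼ·Cⱼₖ|`. [folklore] -/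
def btR (k : Fin n) : ℝ := ((n - 1)! : ℝ) * P.N * P.Bexp * P.Alast * ∑ j ∈ Ioi k, 1 / P.A j + P.N * P.Bexp * P.Alast / P.A k

/-! ### The two directional atoms -/

/-- jets box majorant `ΓR lev k = LbR lev k + 2·btR k·((2Bv last+1)/N + 2) ≥ GammaC (Lb lev) k`. [cite: Nesterenko2003, §4.2 (4.22); shape only] -/
def ΓR (lev : ℕ) (k : Fin n) : ℝ := (P.LbR lev k : ℝ) + 2 * P.btR k * ((2 * P.Bv P.jl + 1 : ℝ) / P.N + 2)

/-- jets scalar majorant `yR lev = Σₖ AθR k·ΓR lev k ≥ Σₖ Aₖ·Γₖ`. [cite: Nesterenko2003, §4.2 Lemma 4.3; shape only] -/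
def yR (lev : ℕ) : ℝ := ∑ k, P.AθR k * P.ΓR lev k

/-- the Cauchy radius of the jets line: `CR lev = max 1 (yR lev / T lev)`. [folklore] -/
def CR (lev : ℕ) : ℝ := max 1 (P.yR lev / P.T lev)

/-- Δ-weight ceiling majorant `YR lev = Σₖ (B·N·LbR lev k + 2·btR k·(2Bv last + 3)) ≥ YC 1 0 (Lb lev)`. [cite: Nesterenko2003, §3.5 (3.36); shape only] -/
def YR (lev : ℕ) : ℝ := ∑ k, (P.Bexp * P.N * (P.LbR lev k : ℝ) + 2 * P.btR k * (2 * P.Bv P.jl + 3 : ℝ))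

/-! ### Globals -/

/-- `cUR = log(L₀+1) + Σⱼ log(2Bv j + 2) ≥ log #unkA`. [cite: Nesterenko2003, §3.5 (3.22)–(3.23); shape only] -/
def cUR : ℝ := Real.log (P.L₀ + 1 : ℝ) + ∑ j, Real.log (2 * P.Bv j + 2 : ℝ)

/-- `logAmaxRR` — the right-hand side of lp-1's `log_AmaxR_le` at `(c, e) = (1, 0)`, `V = A`, with `YC 1 0 (2·sθR) ≤ YR 0`.
[cite: Nesterenko2003, §3.5 (3.37), Prop. 3.9; shape only] -/
def logAmaxRR : ℝ :=
  (P.Tf 0 0 : ℝ) * (1 + Real.log (1 + P.YR 0 / (P.Tf 0 0 : ℕ))) +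
  (Real.log 2 + 23 / 20 * (P.Tf 0 0) * P.H +
    (((P.Sd * P.Tf 0 0 : ℕ) : ℝ) * Real.log 2 + P.H / Real.exp 1 + P.L₀ * (1 + Real.log (1 + (2 : ℝ) ^ P.Sd * (P.Nf 0 0 : ℝ) / P.H)))) +
  (2 * (P.Nf 0 0 : ℝ) * ∑ j, ((P.LνRR 0 j : ℝ) / P.N) * P.A j + 2 * ∑ j, P.A j) +
  P.wl 0 * (P.Nf 0 0 : ℕ)

/-- `cPR = log 2 + cUR + logAmaxRR ≥ log ⌈#unkA·AmaxR⌉`. [folklore] -/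
def cPR : ℝ := Real.log 2 + P.cUR + P.logAmaxRR

/-- `cHR = n·Σ Aⱼ ≥ log ∏ⱼ H(θⱼ)`. [cite: Nesterenko2003, §4.3 (4.45); shape only] -/
def cHR : ℝ := n * P.SAR

/-- `U0 c = cⁿ·Ω·W` (`δ₀ = exp(−U0)`, the negated crux bound). [folklore] -/
def U0 (c : ℝ) : ℝ := c ^ n * P.Ω * P.W

/-- `δ₀ = exp(−U0 c)`. [folklore] -/
def δR (c : ℝ) : ℝ := Real.exp (-P.U0 c)

/-- box ceiling `cbR c lev m = log 2 + log(LbR lev last + 1) + log(m+1) − U0 c` (`2·LbR·δ₀·m ≤ exp cbR`). [folklore] -/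
def cbR (c : ℝ) (lev m : ℕ) : ℝ := Real.log 2 + Real.log (P.LbR lev P.jl + 1 : ℝ) + Real.log (m + 1 : ℝ) - P.U0 c

/-- virtual denominator ceiling `cDR lev a x = (23/20)·a·H + 2x·Σⱼ(LνRR lev j/N)·Aⱼ + 2·Σ Aⱼ`. [cite: Nesterenko2003, §3.5 Lemma 3.11 (3.42); shape only] -/
def cDR (lev a : ℕ) (x : ℝ) : ℝ := 23 / 20 * a * P.H + 2 * x * (∑ j, ((P.LνRR lev j : ℝ) / P.N) * P.A j) + 2 * P.SAR

/-! ### One step's closed lines -/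

/-- **Closed k-step lines at `(lev, ν) → (lev, ν+1)`** (text of ✓ `KStepLinesV` with the record schedule and the closed atoms; `y/C ↦ t`).
[cite: Nesterenko2003, §4.2 (4.24)–(4.35), p. 87–90; shape only] -/
def KStepLinesR (c : ℝ) (lev ν : ℕ) : Prop :=
  1 ≤ P.T lev ∧ P.Tf lev (ν + 1) + P.T lev ≤ P.Tf lev ν ∧ P.Nf lev (ν + 1) ≤ 3 * P.Nf lev ν + 2 ∧
  (P.LbR lev P.jl : ℝ) * P.δR c * (3 * P.Nf lev ν + 2) ≤ 1 ∧
  (∀ (x₁ : ℤ) (a : ℕ), |x₁| ≤ (P.Nf lev (ν + 1) : ℤ) → a < P.Tf lev (ν + 1) →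
    P.γb lev * P.Nf lev (ν + 1) +
      Real.log (2 * ((2 * P.Nf lev ν + 1 : ℕ) : ℝ) ^ (P.T lev + 1) * P.T lev * (20 * Real.exp 1) ^ ((2 * P.Nf lev ν + 1) * P.T lev)) +
      P.T lev * Real.log (2 * P.CR lev) + P.γb lev * (P.Nf lev ν + 1) + a * Real.log 2 + P.T lev + P.cUR + P.cPR +
      Real.log (DΔC (P.YR lev) (P.Tf lev (ν + 1))) + Real.log (WC P.H (P.Sd - lev) P.L₀ (P.Tf lev ν) (3 * P.Nf lev ν + 2)) +
      (P.γb lev + P.wl lev) * P.Nf lev ν + P.cbR c lev (P.Nf lev ν) + P.cDR lev a |(x₁ : ℝ)| + Real.log 3 ≤ 0) ∧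
  (∀ (x₁ : ℤ) (a : ℕ), |x₁| ≤ (P.Nf lev (ν + 1) : ℤ) → a < P.Tf lev (ν + 1) →
    P.γb lev * P.Nf lev (ν + 1) + P.cUR + P.cPR + Real.log (DΔC (P.YR lev) (P.Tf lev (ν + 1))) +
      Real.log (WC P.H (P.Sd - lev) P.L₀ (P.Tf lev (ν + 1)) ((3 * Real.exp (G n) + 1) * (2 * P.Nf lev ν + 1) + P.Nf lev ν)) +
      (P.wl lev + (P.LbR lev P.jl : ℝ) * P.δR c) * ((3 * Real.exp (G n) + 1) * (2 * P.Nf lev ν + 1) + P.Nf lev ν) -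
      (((2 * P.Nf lev ν + 1) * P.T lev : ℕ) : ℝ) * G n + P.cDR lev a |(x₁ : ℝ)| + Real.log 3 ≤ 0) ∧
  (∀ (x₁ : ℤ) (a : ℕ), |x₁| ≤ (P.Nf lev (ν + 1) : ℤ) → a < P.Tf lev (ν + 1) →
    P.cUR + P.cPR + Real.log (DΔC (P.YR lev) (P.Tf lev (ν + 1))) + Real.log (WC P.H (P.Sd - lev) P.L₀ (P.Tf lev ν) (3 * P.Nf lev ν + 2)) +
      (P.γb lev + P.wl lev) * P.Nf lev (ν + 1) + P.cbR c lev (P.Nf lev (ν + 1)) + P.cDR lev a |(x₁ : ℝ)| + Real.log 3 < 0)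

/-- **Closed odd-node k-step lines at `(lev, 0) → (lev, 1)`** (`lev ≥ 1`; `m := Nh lev = Xs lev`; text of ✓ `OddStepLinesV`).
[cite: Nesterenko2003, §4.2 with the nodes 𝒳_{s,0}, p. 87–90; shape only] -/
def OddStepLinesR (c : ℝ) (lev : ℕ) : Prop :=
  1 ≤ P.Nh lev ∧ 1 ≤ P.T lev ∧ P.Tf lev 1 + P.T lev ≤ P.Tf lev 0 ∧ P.Nf lev 1 ≤ 6 * P.Nh lev ∧
  (P.LbR lev P.jl : ℝ) * P.δR c * (6 * P.Nh lev) ≤ 1 ∧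
  (∀ (x₁ : ℤ) (a : ℕ), |x₁| ≤ (P.Nf lev 1 : ℤ) → a < P.Tf lev 1 →
    P.γb lev * P.Nf lev 1 +
      Real.log (2 * ((2 * P.Nh lev : ℕ) : ℝ) ^ (P.T lev + 1) * P.T lev * (20 * Real.exp 1) ^ ((2 * P.Nh lev) * P.T lev)) +
      P.T lev * Real.log 2 + P.T lev * Real.log (2 * P.CR lev) + P.γb lev * (2 * P.Nh lev) + a * Real.log 2 + P.T lev + P.cUR + P.cPR +
      Real.log (DΔC (P.YR lev) (P.Tf lev 1)) + Real.log (WC P.H (P.Sd - lev) P.L₀ (P.Tf lev 0) (6 * P.Nh lev)) +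
      (P.γb lev + P.wl lev) * ((2 * P.Nh lev - 1 : ℕ) : ℝ) + P.cbR c lev (2 * P.Nh lev - 1) + P.cDR lev a |(x₁ : ℝ)| + Real.log 3 ≤ 0) ∧
  (∀ (x₁ : ℤ) (a : ℕ), |x₁| ≤ (P.Nf lev 1 : ℤ) → a < P.Tf lev 1 →
    P.γb lev * P.Nf lev 1 + P.cUR + P.cPR + Real.log (DΔC (P.YR lev) (P.Tf lev 1)) +
      Real.log (WC P.H (P.Sd - lev) P.L₀ (P.Tf lev 1) ((12 * Real.exp (G n) + 6) * P.Nh lev)) +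
      (P.wl lev + (P.LbR lev P.jl : ℝ) * P.δR c) * ((12 * Real.exp (G n) + 6) * P.Nh lev) -
      (((2 * P.Nh lev) * P.T lev : ℕ) : ℝ) * G n + P.cDR lev a |(x₁ : ℝ)| + Real.log 3 ≤ 0) ∧
  (∀ (x₁ : ℤ) (a : ℕ), |x₁| ≤ (P.Nf lev 1 : ℤ) → a < P.Tf lev 1 →
    P.cUR + P.cPR + Real.log (DΔC (P.YR lev) (P.Tf lev 1)) + Real.log (WC P.H (P.Sd - lev) P.L₀ (P.Tf lev 0) (6 * P.Nh lev)) +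
      (P.γb lev + P.wl lev) * P.Nf lev 1 + P.cbR c lev (P.Nf lev 1) + P.cDR lev a |(x₁ : ℝ)| + Real.log 3 < 0)

/-- **Closed half-step lines at `(lev, n) → (lev+1, 0)`** (`ex := Ŝ − (lev+1)`, `N := Nf lev n`, `N₁ := Nh (lev+1)`; text of ✓ `HalfStepLinesV`
with the threshold exponent `Θ = 2ⁿ·(log 4 + cDh + (log 2 + cUR + cPR + log DΔC + log MtV) + 2·cHR)`, `log MtV = log WC(H, ex+1, L₀, T′, N₁) +
(γb+w)·N₁ + AθsumR/2`, `Σ(colU/N)·A ↦ n·SAR`). [cite: Nesterenko2003, §4.3 (4.36)–(4.51), p. 90–95; shape only] -/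
def HalfStepLinesR (c : ℝ) (lev : ℕ) : Prop :=
  1 ≤ P.T lev ∧ P.Tf (lev + 1) 0 + P.T lev ≤ P.Tf lev n ∧ 2 * P.Nh (lev + 1) ≤ 6 * P.Nf lev n + 5 ∧
  (P.LbR lev P.jl : ℝ) * P.δR c * (3 * P.Nf lev n + 2) ≤ 1 ∧
  (∀ (s : ℤ) (a : ℕ), Odd s → |s| ≤ 2 * (P.Nh (lev + 1) : ℤ) - 1 → a < P.Tf (lev + 1) 0 →
    P.γb lev * (3 * P.Nf lev n + 2) +
      Real.log (2 * ((2 * P.Nf lev n + 1 : ℕ) : ℝ) ^ (P.T lev + 1) * P.T lev * (20 * Real.exp 1) ^ ((2 * P.Nf lev n + 1) * P.T lev)) +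
      P.T lev * Real.log (2 * P.CR lev) + P.γb lev * (P.Nf lev n + 1) + a * Real.log 2 + P.T lev + P.cUR + P.cPR +
      Real.log (DΔC (P.YR lev) (P.Tf (lev + 1) 0)) + Real.log (WC P.H (P.Sd - (lev + 1) + 1) P.L₀ (P.Tf lev n) (P.Nf lev n)) +
      (P.γb lev + P.wl lev) * P.Nf lev n + P.cbR c lev (P.Nf lev n) +
      (2 : ℝ) ^ n * (Real.log 4 + (23 / 20 * a * P.H + (|(s : ℝ)| * ∑ j, ((P.LνRR lev j : ℝ) / P.N) * P.A j + n * P.SAR + 2 * P.SAR)) +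
        (Real.log 2 + P.cUR + P.cPR + Real.log (DΔC (P.YR lev) (P.Tf (lev + 1) 0)) +
          (Real.log (WC P.H (P.Sd - (lev + 1) + 1) P.L₀ (P.Tf (lev + 1) 0) (P.Nh (lev + 1))) + (P.γb lev + P.wl lev) * P.Nh (lev + 1) +
            P.AθsumR / 2)) + 2 * P.cHR) +
      Real.log 3 ≤ 0) ∧
  (∀ (s : ℤ) (a : ℕ), Odd s → |s| ≤ 2 * (P.Nh (lev + 1) : ℤ) - 1 → a < P.Tf (lev + 1) 0 →
    P.γb lev * (3 * P.Nf lev n + 2) + P.cUR + P.cPR + Real.log (DΔC (P.YR lev) (P.Tf (lev + 1) 0)) +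
      Real.log (WC P.H (P.Sd - (lev + 1) + 1) P.L₀ (P.Tf (lev + 1) 0) ((3 * Real.exp (G n) + 1) * (2 * P.Nf lev n + 1) + P.Nf lev n)) +
      (P.wl lev + (P.LbR lev P.jl : ℝ) * P.δR c) * ((3 * Real.exp (G n) + 1) * (2 * P.Nf lev n + 1) + P.Nf lev n) -
      (((2 * P.Nf lev n + 1) * P.T lev : ℕ) : ℝ) * G n +
      (2 : ℝ) ^ n * (Real.log 4 + (23 / 20 * a * P.H + (|(s : ℝ)| * ∑ j, ((P.LνRR lev j : ℝ) / P.N) * P.A j + n * P.SAR + 2 * P.SAR)) +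
        (Real.log 2 + P.cUR + P.cPR + Real.log (DΔC (P.YR lev) (P.Tf (lev + 1) 0)) +
          (Real.log (WC P.H (P.Sd - (lev + 1) + 1) P.L₀ (P.Tf (lev + 1) 0) (P.Nh (lev + 1))) + (P.γb lev + P.wl lev) * P.Nh (lev + 1) +
            P.AθsumR / 2)) + 2 * P.cHR) +
      Real.log 3 ≤ 0) ∧
  (∀ (s : ℤ) (a : ℕ), Odd s → |s| ≤ 2 * (P.Nh (lev + 1) : ℤ) - 1 → a < P.Tf (lev + 1) 0 →
    P.cUR + P.cPR + Real.log (DΔC (P.YR lev) (P.Tf (lev + 1) 0)) + Real.log (WC P.H (P.Sd - (lev + 1) + 1) P.L₀ (P.Tf (lev + 1) 0) (P.Nh (lev + 1))) +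
      (P.γb lev + P.wl lev) * (3 * P.Nf lev n + 2) + P.cbR c lev (3 * P.Nf lev n + 2) +
      (2 : ℝ) ^ n * (Real.log 4 + (23 / 20 * a * P.H + (|(s : ℝ)| * ∑ j, ((P.LνRR lev j : ℝ) / P.N) * P.A j + n * P.SAR + 2 * P.SAR)) +
        (Real.log 2 + P.cUR + P.cPR + Real.log (DΔC (P.YR lev) (P.Tf (lev + 1) 0)) +
          (Real.log (WC P.H (P.Sd - (lev + 1) + 1) P.L₀ (P.Tf (lev + 1) 0) (P.Nh (lev + 1))) + (P.γb lev + P.wl lev) * P.Nh (lev + 1) +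
            P.AθsumR / 2)) + 2 * P.cHR) +
      Real.log 3 < 0)

/-! ### All levels -/

/-- **THE LETTER LINES IN CLOSED FORM** at the constant `c` (level-wise exactly as `ArchLinesHoldV`/`ArchPacksHoldV`: level `0`:
`KStepLinesR` at `(0, ν)`, `ν < n`; for every `lev < Ŝ`: `HalfStepLinesR` at `lev`, `OddStepLinesR` at `lev+1`, `KStepLinesR` at `(lev+1, ν)`,
`1 ≤ ν < n`).  Record-side content of `stub_recLinesArch`; proved by seat p1 (`linesClosed_holds`). [cite: Nesterenko2003, §4 Prop. 4.1, §4.2–4.3,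
p. 80–95; shape only] -/
def LinesClosed (c : ℝ) : Prop :=
  (∀ ν, ν < n → P.KStepLinesR c 0 ν) ∧
  (∀ lev < P.Sd, P.HalfStepLinesR c lev) ∧
  (∀ lev < P.Sd, P.OddStepLinesR c (lev + 1)) ∧
  (∀ lev < P.Sd, ∀ ν, 1 ≤ ν → ν < n → P.KStepLinesR c (lev + 1) ν)

end ArchG3Rec

end Summit.ABC.StewartYu

end
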